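/-
Copyright (c) 2026 the pub-hodgecm-mathlib formalisation cell (harness21).  Prover seat hodgecm-mathlib-A-p16 (g31), architect of the «P-1-ram» row of the «S3-ram» seeding wave
(LEAD F0P3a-plan (g12); owner F0P3a-p06 (g15); fold pen F0P3-p02 (g16)), 2026-09-02.
-/
import Literature.NumberTheory.Automorphic.UnitaryLevelOnePieceOrbitalIntegralRamified   -- ★ p847154 (F0P3a-p05 (g16)): the six-strata orbital integral `classOrbitalIntegral_eq_mul_sixStrata_of_vDeep_ramified`
import Mathlib.FieldTheory.Finite.Basic
import HarnessLib

/-!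
# «(O8b)-ram» IN THE FOLD'S CURRENCY: the FIVE-STRATA orbital integral of a `v`-level-1 `K`-class piece at a `v`-deep regular class (tame-ramified non-split place),
# with the two rank-one values as the constants `c₁s ∣ c₁n` of the square ∣ non-square class (no residue-indexed reader, no chosen non-square)

Topic `NumberTheory/Automorphic`; namespace `Literature.NumberTheory.Automorphic.UnitaryGroup`.  ONE THEOREM (no definition, no instance, no notation, no named fact, no `sorry`);
kernel lane `--supports stmt-HodgeConjecture-24833`.  Cell `pub/hodgecm-mathlib` (D-0151), crux H413; «S3-ram» seeding wave (LEAD F0P3a-plan (g12); owner F0P3a-p06 (g15)), row «P-1-ram»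
(architect A-p16 (g31)): the ADAPTER «(C-adapt)» between ★ p847154 (F0P3a-p05 (g16)) and the strata binders `(c₂) (c′) (hc) (hc′) (c₁s c₁n) (hR4s) (hR4n)` of the fold's sockets
(T1)∕(T2) (fold v7.1, pen F0P3-p02 (g16)) — the input (C) of the κ-signed class sum (Σ) `stub_typeOne_signedClassSum_ram` (skeleton v7).  HONEST LABEL: HC_CM is proved only
modulo the cell's 2 remaining named inputs (hLiu418 24832, h413 24833) until rung 0 closes; «S3-ram» is Literature seeding with no books consequence; unconditional bookkeeping.

THE MATHEMATICS ([Rogawski1990] §4.9 pp. 54–55; [Kottwitz1986] §3; [Laumon1995] (5.3.2)).  ★ `classOrbitalIntegral_eq_mul_sixStrata_of_vDeep_ramified` reads a `v`-level-1 piece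
`g` through a residue-indexed rank-one reader `c₁ : 𝓀_w → ℂ` (rows (R4)(R5): `g x = c₁(zᵀ(J̄N(x))z)`, `c₁(a²t) = c₁(t)`) and a chosen residue non-square `ε`, and returns
`Φ(⟦t⟧, g) = ν_G(K′)·(c 2·n_bd + c′ 0·n_0 + c′ 2·n_reg + c₁ 1·n_□ + c₁ ε·n_¬□)`.  The fold's sockets carry instead the two CONSTANTS `c₁s` (square class) ∣ `c₁n` (non-square class)
with the rows `hR4s`∕`hR4n`.  Setting `c₁ t := if IsSquare t then c₁s else c₁n` (square-class invariant since `IsSquare (a²t) ↔ IsSquare t` for `a ≠ 0`) and taking ANY residue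
non-square `ε` (★ `FiniteField.exists_nonsquare`; `2 ∈ 𝒪_w^×` so `char 𝓀_w ≠ 2`) gives `c₁ 1 = c₁s`, `c₁ ε = c₁n`:
**`Φ(⟦t⟧, g) = ν_G(K′)·(c₂·n_bd(t) + c′ 0·n_0(t) + c′ 2·n_reg(t) + c₁s·n_□(t) + c₁n·n_¬□(t))`** with ★ p847154's five count sets VERBATIM.

## References
* [Rogawski1990] J. D. Rogawski, *Automorphic Representations of Unitary Groups in Three Variables*, Ann. of Math. Stud. 123 (1990): §4.9 pp. 54–55, Prop. 4.9.1.
* [Kottwitz1986] R. E. Kottwitz, *Base change for unit elements of Hecke algebras*, Compositio Math. 60 (1986): §3.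
* [Laumon1995] G. Laumon, *Cohomology of Drinfeld Modular Varieties* I (1996): Lemma (5.3.2) p. 136.
-/

set_option autoImplicit false

noncomputable section

open MeasureTheory Measure Set Filter Topology NumberField IsDedekindDomain Matrix ValuativeRel
open Literature.NumberTheory.Rogawski1990 Literature.NumberTheory.GaloisRepresentations Literature.NumberTheory.Automorphic.UnitaryGroup
open Literature.NumberTheory.Automorphic.IntegralReduction Literature.GroupTheory.SpecificGroups Literature.NumberTheory.Automorphic.UnitaryLatticeTree
open scoped Matrix MatrixGroups ValuativeRel

namespace Literature.NumberTheory.Automorphic.UnitaryGroup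

/-- Over a field, multiplying by a non-zero square does not change the square class. [folklore] -/
private theorem isSquare_sq_mul_iff {F : Type*} [Field F] {a : F} (ha : a ≠ 0) (t : F) : IsSquare (a ^ 2 * t) ↔ IsSquare t := by
  constructor
  · rintro ⟨r, hr⟩
    refine ⟨r / a, ?_⟩
    field_simp
    linear_combination hr
  · rintro ⟨r, hr⟩
    exact ⟨a * r, by rw [hr]; ring⟩

set_option maxHeartbeats 1600000 in
-- budget only: statement-heavy declaration (five count sets in the CM-place tokens, six row hypotheses); no search tactic runs long here.
/-- **«(O8b)-ram» IN THE FOLD'S CURRENCY — THE FIVE-STRATA ORBITAL INTEGRAL OF A `v`-LEVEL-1 `K`-CLASS PIECE AT A `v`-DEEP REGULAR CLASS** (tame-ramified non-split place):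
for `t ∈ G′_v` regular with compact centraliser and `v`-deep, `g` locally constant, supported in `K′`, `Ad K′`-invariant, with strata values `c₂` (boundary), `c′ 0 ∣ c′ 2` (depth-1
residue of rank `0 ∣ 2`), `c₁s ∣ c₁n` (rank 1, square ∣ non-square class) — the fold's (T1)∕(T2) binder rows `hc hc′ hR4s hR4n` VERBATIM:
`Φ(⟦t⟧, g) = ν_G(K′)·(c₂·n_bd(t) + c′ 0·n_0(t) + c′ 2·n_reg(t) + c₁s·n_□(t) + c₁n·n_¬□(t))`, the five count sets of ★ `classOrbitalIntegral_eq_mul_sixStrata_of_vDeep_ramified` VERBATIM.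
[cite: Rogawski1990, §4.9 pp. 54–55, Prop. 4.9.1] [cite: Laumon1995, Lemma (5.3.2) p. 136] [cite: Kottwitz1986, §3] -/
theorem classOrbitalIntegral_eq_mul_fiveStrata_of_vDeep_ramified
    (L : Type) [Field L] [NumberField L] [IsCMField L] (H' : Matrix (Fin 3) (Fin 3) L) {v : HeightOneSpectrum (𝓞 ↥(maximalRealSubfield L))}
    [MeasurableSpace ((cmDatum L 3 H').Local v)] [BorelSpace ((cmDatum L 3 H').Local v)]
    [∀ γ : ((cmDatum L 3 H').Local v), MeasurableSpace (((cmDatum L 3 H').Local v) ⧸ Subgroup.centralizer ({γ} : Set ((cmDatum L 3 H').Local v)))]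
    [∀ γ : ((cmDatum L 3 H').Local v), BorelSpace (((cmDatum L 3 H').Local v) ⧸ Subgroup.centralizer ({γ} : Set ((cmDatum L 3 H').Local v)))]
    (νG : Measure ((cmDatum L 3 H').Local v)) [νG.IsHaarMeasure] [νG.IsMulRightInvariant]
    (hH' : (H'.map (cmConjRingHom L)).transpose = H') (w : PlacesOver L v)
    (hw : IsCMField.complexConj L • w.1 = w.1) (he : v.asIdeal.ramificationIdx' w.1.asIdeal ≠ 1)
    (hH'w : IsUnit (placeForm H' w.1)) (hH'i : hH'w.unit ∈ glInt 3 (w.1.adicCompletion L))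
    (h2 : IsUnit (2 : 𝒪[(w.1.adicCompletion L)]))
    (ϖ : (w.1.adicCompletion L)) (hϖ : Valued.v ϖ = WithZero.exp (-1 : ℤ)) (hσϖ : (galAdicCompletionMap (L := L) (IsCMField.complexConj L) hw) ϖ = -ϖ)
    (A : GL (Fin 3) (w.1.adicCompletion L)) (hA : A ∈ glInt 3 (w.1.adicCompletion L))
    (hframe : (placeForm H' w.1) = (-(placeForm H' w.1).det) • formCongr (galAdicCompletionMap (L := L) (IsCMField.complexConj L) hw) A ((StdForm.antidiagonal 3).over (w.1.adicCompletion L)))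
    {mG : OrbitalMeasureFamily ((cmDatum L 3 H').Local v)} (hmG : mG.IsCanonical (fun γ => IsRegularElt (γ.val : GL (Fin 3) (UnitaryGroup.LocalRing L v))) νG)
    (t : ((cmDatum L 3 H').Local v)) (hreg : IsRegularElt (t.val : GL (Fin 3) (UnitaryGroup.LocalRing L v)))
    [CompactSpace (Subgroup.centralizer ({t} : Set ((cmDatum L 3 H').Local v)))]
    (htdeep : (∀ a b, Valued.v (((toPlace v w (HeckeCharacter.uniformizer ↥(maximalRealSubfield L) v : v.adicCompletion ↥(maximalRealSubfield L))) ^ 1)⁻¹ * ((((t).val : GL (Fin 3) (UnitaryGroup.LocalRing L v)).val.map (Pi.evalRingHom (fun w' : PlacesOver L v => w'.1.adicCompletion L) w)) a b - (1 : Matrix (Fin 3) (Fin 3) (w.1.adicCompletion L)) a b)) ≤ 1))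
    (g : ((cmDatum L 3 H').Local v) → ℂ) (hg : Literature.NumberTheory.Rogawski1990.IsLocSmooth g) (hgK : tsupport g ⊆ ((cmLocalIntegralLevel L 3 H' v) : Set ((cmDatum L 3 H').Local v)))
    (hginv : ∀ u ∈ (cmLocalIntegralLevel L 3 H' v), ∀ x, g (u * x * u⁻¹) = g x)
    -- the two-layer strata values of `g` (★ F0P2-p01 head rows VERBATIM, in the (L)-ram L5-C2 binder shapes)
    (c₂ : ℂ) (c' : ℕ → ℂ) (hc : ∀ x : ((cmDatum L 3 H').Local v), (x ∈ cmLocalIntegralLevel L 3 H' v ∧ (redMat (((x).val : GL (Fin 3) (UnitaryGroup.LocalRing L v)).val.map (Pi.evalRingHom (fun w' : PlacesOver L v => w'.1.adicCompletion L) w)) - 1) ^ 3 = 0 ∧ (redMat (((x).val : GL (Fin 3) (UnitaryGroup.LocalRing L v)).val.map (Pi.evalRingHom (fun w' : PlacesOver L v => w'.1.adicCompletion L) w)) - 1).rank = 2 ∧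
        ∃ y : ((cmDatum L 3 H').Local v), (∀ a b, Valued.v (((toPlace v w (HeckeCharacter.uniformizer ↥(maximalRealSubfield L) v : v.adicCompletion ↥(maximalRealSubfield L))) ^ 1)⁻¹ *
        ((((localNonsplitEquiv (IsCMField.complexConj L) H' (IsCMField.complexConj_ne_one L) w hw (y * x * y⁻¹) :
            ↥(unitaryGroupOfForm (galAdicCompletionMap (L := L) (IsCMField.complexConj L) hw) (placeForm H' w.1))) : GL (Fin 3) (w.1.adicCompletion L)) :
              Matrix (Fin 3) (Fin 3) (w.1.adicCompletion L)) a b - (1 : Matrix (Fin 3) (Fin 3) (w.1.adicCompletion L)) a b)) ≤ 1)) → g x = c₂)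
    (hc' : ((∀ x : ((cmDatum L 3 H').Local v), (x ∈ cmLocalIntegralLevel L 3 H' v ∧ (∀ a b, Valued.v (ϖ⁻¹ * ((((x).val : GL (Fin 3) (UnitaryGroup.LocalRing L v)).val.map (Pi.evalRingHom (fun w' : PlacesOver L v => w'.1.adicCompletion L) w)) a b - (1 : Matrix (Fin 3) (Fin 3) (w.1.adicCompletion L)) a b)) ≤ 1) ∧
        (redMat (ϖ⁻¹ • ((((x).val : GL (Fin 3) (UnitaryGroup.LocalRing L v)).val.map (Pi.evalRingHom (fun w' : PlacesOver L v => w'.1.adicCompletion L) w)) - 1))) ^ 3 = 0 ∧ (redMat (ϖ⁻¹ • ((((x).val : GL (Fin 3) (UnitaryGroup.LocalRing L v)).val.map (Pi.evalRingHom (fun w' : PlacesOver L v => w'.1.adicCompletion L) w)) - 1))).rank = 0) → g x = c' 0) ∧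
      (∀ x : ((cmDatum L 3 H').Local v), (x ∈ cmLocalIntegralLevel L 3 H' v ∧ (∀ a b, Valued.v (ϖ⁻¹ * ((((x).val : GL (Fin 3) (UnitaryGroup.LocalRing L v)).val.map (Pi.evalRingHom (fun w' : PlacesOver L v => w'.1.adicCompletion L) w)) a b - (1 : Matrix (Fin 3) (Fin 3) (w.1.adicCompletion L)) a b)) ≤ 1) ∧
        (redMat (ϖ⁻¹ • ((((x).val : GL (Fin 3) (UnitaryGroup.LocalRing L v)).val.map (Pi.evalRingHom (fun w' : PlacesOver L v => w'.1.adicCompletion L) w)) - 1))) ^ 3 = 0 ∧ (redMat (ϖ⁻¹ • ((((x).val : GL (Fin 3) (UnitaryGroup.LocalRing L v)).val.map (Pi.evalRingHom (fun w' : PlacesOver L v => w'.1.adicCompletion L) w)) - 1))).rank = 2) → g x = c' 2)))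
    (c₁s c₁n : ℂ)
    (hR4s : (∀ (x : ((cmDatum L 3 H').Local v)) (z : Fin 3 → 𝓀[(w.1.adicCompletion L)]), (x ∈ cmLocalIntegralLevel L 3 H' v ∧
        (∀ a b, Valued.v (ϖ⁻¹ * ((((x).val : GL (Fin 3) (UnitaryGroup.LocalRing L v)).val.map (Pi.evalRingHom (fun w' : PlacesOver L v => w'.1.adicCompletion L) w)) a b - (1 : Matrix (Fin 3) (Fin 3) (w.1.adicCompletion L)) a b)) ≤ 1) ∧
        (redMat (ϖ⁻¹ • ((((x).val : GL (Fin 3) (UnitaryGroup.LocalRing L v)).val.map (Pi.evalRingHom (fun w' : PlacesOver L v => w'.1.adicCompletion L) w)) - 1))) ^ 3 = 0 ∧ (redMat (ϖ⁻¹ • ((((x).val : GL (Fin 3) (UnitaryGroup.LocalRing L v)).val.map (Pi.evalRingHom (fun w' : PlacesOver L v => w'.1.adicCompletion L) w)) - 1))).rank = 1 ∧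
        z ⬝ᵥ ((redMat (placeForm H' w.1) * redMat (ϖ⁻¹ • ((((x).val : GL (Fin 3) (UnitaryGroup.LocalRing L v)).val.map (Pi.evalRingHom (fun w' : PlacesOver L v => w'.1.adicCompletion L) w)) - 1))) *ᵥ z) ≠ 0 ∧ IsSquare (z ⬝ᵥ ((redMat (placeForm H' w.1) * redMat (ϖ⁻¹ • ((((x).val : GL (Fin 3) (UnitaryGroup.LocalRing L v)).val.map (Pi.evalRingHom (fun w' : PlacesOver L v => w'.1.adicCompletion L) w)) - 1))) *ᵥ z))) →
        g x = c₁s))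
    (hR4n : (∀ (x : ((cmDatum L 3 H').Local v)) (z : Fin 3 → 𝓀[(w.1.adicCompletion L)]), (x ∈ cmLocalIntegralLevel L 3 H' v ∧
        (∀ a b, Valued.v (ϖ⁻¹ * ((((x).val : GL (Fin 3) (UnitaryGroup.LocalRing L v)).val.map (Pi.evalRingHom (fun w' : PlacesOver L v => w'.1.adicCompletion L) w)) a b - (1 : Matrix (Fin 3) (Fin 3) (w.1.adicCompletion L)) a b)) ≤ 1) ∧
        (redMat (ϖ⁻¹ • ((((x).val : GL (Fin 3) (UnitaryGroup.LocalRing L v)).val.map (Pi.evalRingHom (fun w' : PlacesOver L v => w'.1.adicCompletion L) w)) - 1))) ^ 3 = 0 ∧ (redMat (ϖ⁻¹ • ((((x).val : GL (Fin 3) (UnitaryGroup.LocalRing L v)).val.map (Pi.evalRingHom (fun w' : PlacesOver L v => w'.1.adicCompletion L) w)) - 1))).rank = 1 ∧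
        z ⬝ᵥ ((redMat (placeForm H' w.1) * redMat (ϖ⁻¹ • ((((x).val : GL (Fin 3) (UnitaryGroup.LocalRing L v)).val.map (Pi.evalRingHom (fun w' : PlacesOver L v => w'.1.adicCompletion L) w)) - 1))) *ᵥ z) ≠ 0 ∧ ¬ IsSquare (z ⬝ᵥ ((redMat (placeForm H' w.1) * redMat (ϖ⁻¹ • ((((x).val : GL (Fin 3) (UnitaryGroup.LocalRing L v)).val.map (Pi.evalRingHom (fun w' : PlacesOver L v => w'.1.adicCompletion L) w)) - 1))) *ᵥ z))) →
        g x = c₁n)) :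
    classOrbitalIntegral mG g (ConjClasses.mk t) =
      (νG.real ((cmLocalIntegralLevel L 3 H' v) : Set ((cmDatum L 3 H').Local v)) : ℂ) *
        (c₂ * ({q : (((cmDatum L 3 H').Local v) ⧸ cmLocalIntegralLevel L 3 H' v) | q ∈ MulAction.fixedBy (((cmDatum L 3 H').Local v) ⧸ cmLocalIntegralLevel L 3 H' v) t ∧ (redMat (((((q.out⁻¹ * t * q.out)).val : GL (Fin 3) (UnitaryGroup.LocalRing L v)).val.map (Pi.evalRingHom (fun w' : PlacesOver L v => w'.1.adicCompletion L) w))) - 1).rank = 2}.ncard : ℂ) +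
          c' 0 * ({q : (((cmDatum L 3 H').Local v) ⧸ cmLocalIntegralLevel L 3 H' v) | q ∈ MulAction.fixedBy (((cmDatum L 3 H').Local v) ⧸ cmLocalIntegralLevel L 3 H' v) t ∧ (redMat (((((q.out⁻¹ * t * q.out)).val : GL (Fin 3) (UnitaryGroup.LocalRing L v)).val.map (Pi.evalRingHom (fun w' : PlacesOver L v => w'.1.adicCompletion L) w))) - 1).rank = 0 ∧ (redMat (ϖ⁻¹ • (((((q.out⁻¹ * t * q.out)).val : GL (Fin 3) (UnitaryGroup.LocalRing L v)).val.map (Pi.evalRingHom (fun w' : PlacesOver L v => w'.1.adicCompletion L) w)) - 1))).rank = 0}.ncard : ℂ) +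
          c' 2 * ({q : (((cmDatum L 3 H').Local v) ⧸ cmLocalIntegralLevel L 3 H' v) | q ∈ MulAction.fixedBy (((cmDatum L 3 H').Local v) ⧸ cmLocalIntegralLevel L 3 H' v) t ∧ (redMat (((((q.out⁻¹ * t * q.out)).val : GL (Fin 3) (UnitaryGroup.LocalRing L v)).val.map (Pi.evalRingHom (fun w' : PlacesOver L v => w'.1.adicCompletion L) w))) - 1).rank = 0 ∧ (redMat (ϖ⁻¹ • (((((q.out⁻¹ * t * q.out)).val : GL (Fin 3) (UnitaryGroup.LocalRing L v)).val.map (Pi.evalRingHom (fun w' : PlacesOver L v => w'.1.adicCompletion L) w)) - 1))).rank = 2}.ncard : ℂ) +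
          c₁s * ({q : (((cmDatum L 3 H').Local v) ⧸ cmLocalIntegralLevel L 3 H' v) | q ∈ MulAction.fixedBy (((cmDatum L 3 H').Local v) ⧸ cmLocalIntegralLevel L 3 H' v) t ∧ (redMat (((((q.out⁻¹ * t * q.out)).val : GL (Fin 3) (UnitaryGroup.LocalRing L v)).val.map (Pi.evalRingHom (fun w' : PlacesOver L v => w'.1.adicCompletion L) w))) - 1).rank = 0 ∧ (redMat (ϖ⁻¹ • (((((q.out⁻¹ * t * q.out)).val : GL (Fin 3) (UnitaryGroup.LocalRing L v)).val.map (Pi.evalRingHom (fun w' : PlacesOver L v => w'.1.adicCompletion L) w)) - 1))).rank = 1 ∧ ∃ (z : Fin 3 → 𝓀[(w.1.adicCompletion L)]) (a : 𝓀[(w.1.adicCompletion L)]), a ≠ 0 ∧ z ⬝ᵥ ((redMat (placeForm H' w.1) * redMat (ϖ⁻¹ • (((((q.out⁻¹ * t * q.out)).val : GL (Fin 3) (UnitaryGroup.LocalRing L v)).val.map (Pi.evalRingHom (fun w' : PlacesOver L v => w'.1.adicCompletion L) w)) - 1))) *ᵥ z) = a ^ 2}.ncard : ℂ) +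
          c₁n * ({q : (((cmDatum L 3 H').Local v) ⧸ cmLocalIntegralLevel L 3 H' v) | q ∈ MulAction.fixedBy (((cmDatum L 3 H').Local v) ⧸ cmLocalIntegralLevel L 3 H' v) t ∧ (redMat (((((q.out⁻¹ * t * q.out)).val : GL (Fin 3) (UnitaryGroup.LocalRing L v)).val.map (Pi.evalRingHom (fun w' : PlacesOver L v => w'.1.adicCompletion L) w))) - 1).rank = 0 ∧ (redMat (ϖ⁻¹ • (((((q.out⁻¹ * t * q.out)).val : GL (Fin 3) (UnitaryGroup.LocalRing L v)).val.map (Pi.evalRingHom (fun w' : PlacesOver L v => w'.1.adicCompletion L) w)) - 1))).rank = 1 ∧ ¬ ∃ (z : Fin 3 → 𝓀[(w.1.adicCompletion L)]) (a : 𝓀[(w.1.adicCompletion L)]), a ≠ 0 ∧ z ⬝ᵥ ((redMat (placeForm H' w.1) * redMat (ϖ⁻¹ • (((((q.out⁻¹ * t * q.out)).val : GL (Fin 3) (UnitaryGroup.LocalRing L v)).val.map (Pi.evalRingHom (fun w' : PlacesOver L v => w'.1.adicCompletion L) w)) - 1))) *ᵥ z) = a ^ 2}.ncard : ℂ)) :=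 by
  classical
  letI : Fintype 𝓀[(w.1.adicCompletion L)] := Fintype.ofFinite _
  -- `2 ≠ 0` in the residue field, hence a residue non-square exists
  have h2k : (2 : 𝓀[(w.1.adicCompletion L)]) ≠ 0 := by
    have h := h2.map (IsLocalRing.residue 𝒪[(w.1.adicCompletion L)])
    rw [map_ofNat] at h
    exact h.ne_zero
  have hch : ringChar 𝓀[(w.1.adicCompletion L)] ≠ 2 := by
    intro h
    apply h2k
    exact_mod_cast (ringChar.spec 𝓀[(w.1.adicCompletion L)] 2).2 (by rw [h])
  obtain ⟨ε, hε⟩ := FiniteField.exists_nonsquare hch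
  -- the residue-indexed rank-one reader of ★ p847154, constant on the two square classes
  have key := classOrbitalIntegral_eq_mul_sixStrata_of_vDeep_ramified L H' νG hH' w hw he hH'w hH'i h2 ϖ hϖ hσϖ A hA hframe hmG t hreg htdeep g hg hgK hginv
    (fun _ => c₂) c' (fun r => if IsSquare r then c₁s else c₁n) ε hε hc hc'.1 hc'.2
    (fun x z h => by
      obtain ⟨h1, h2', h3, h4, h5⟩ := h
      by_cases hs : IsSquare (z ⬝ᵥ ((redMat (placeForm H' w.1) * redMat (ϖ⁻¹ • ((((x).val : GL (Fin 3) (UnitaryGroup.LocalRing L v)).val.map (Pi.evalRingHom (fun w' : PlacesOver L v => w'.1.adicCompletion L) w)) - 1))) *ᵥ z))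
      · rw [if_pos hs]
        exact hR4s x z ⟨h1, h2', h3, h4, h5, hs⟩
      · rw [if_neg hs]
        exact hR4n x z ⟨h1, h2', h3, h4, h5, hs⟩)
    (fun r a ha => by
      show (if IsSquare (a ^ 2 * r) then c₁s else c₁n) = (if IsSquare r then c₁s else c₁n)
      simp only [isSquare_sq_mul_iff ha])
  simp only [IsSquare.one, if_true, hε, if_false] at key
  exact key

end Literature.NumberTheory.Automorphic.UnitaryGroup

end
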